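import Summits.Ventures.CertifiedManyBodySolver.Theorems.ThermalStiffnessCeilingU8b8_le_7o44.Negative.CurrentCovarianceNonVacuity
import HarnessLib

/-!
# Canonical density covariances at `β = 0`: exchangeability counting and the Lebowitz–Percus–Verlet plateau
(negative-side helpers for the crux K1′ of route `TcThermcert1`)

Disprover's helpers (`--supports stmt-Ventures-24560`; crux K1′ `TcThermcert1.ThermalStiffnessCeilingU8b8_le_7o44`, line of record
`Cruxes/ThermalStiffnessCeilingU8b8_le_7o44/Lines/gauge_qbp_far_seam.lean` v1.4, bet C8 `stub_currentClustering8`): the generic half of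
finding F6 of edition 3 of `Cruxes/ThermalStiffnessCeilingU8b8_le_7o44/Disproof.lean` (the torus instance and the refutation of the
density-clustering strengthening of Hypothesis C are in `CanonicalDensityPlateau.lean`).

TECHNIQUE (different from F1's antiunitary symmetry, F4's zero-diagonal locality and F5's faithfulness): EXCHANGEABILITY + SUM RULES.
In a coordinate sector `R ⊆ Finset (Orb Λ)` that is invariant under swapping two spin-`↑` orbitals and has exactly `M` spin-`↑`
orbitals in every configuration, the `β = 0` (normalised-trace) state `ω_R` satisfies, for sites `x ≠ a`,
* `|Λ| · #{s ∈ R : (x,↑) ∈ s} = M · #R` (`card_mul_card_filter_mem_eq`; `ω_R(n_{x↑}) = M/|Λ|`),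
* `N₁ + (|Λ| - 1) N₂ = M N₁` for the one- and two-point counts (`card_filter_mem_add_eq`; `Σ_a n_{a↑} = M` inside `R`),
hence the exact finite-volume Lebowitz–Percus–Verlet correction (`densityCov_beta_zero_eq`, `densityCov_sector_beta_zero_eq`)
`ω_R(n_{x↑} n_{a↑}) - ω_R(n_{x↑}) ω_R(n_{a↑}) = -M(|Λ| - M) / (|Λ|²(|Λ| - 1))` for EVERY Hamiltonian and EVERY pair of distinct
sites, however far apart: canonical (fixed particle number) states do not cluster in the density beyond `O(1/|Λ|)`.
The `DecidableEq (Finset (Orb Λ))` instance entering the Gibbs state is a binder of the two plateau identities, so that they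
instantiate on the torus with the torus files' shortcut instance (cf. `TcThermcert1FarCutGeometry` §2).

HONEST FRAMING: finite-dimensional folklore (hypergeometric covariance; Lebowitz–Percus–Verlet 1967 §II, Cancrini–Olla 2017 Thm 5.1 for
the thermodynamic version); NO KILL of K1′, of stub B or of the bet C8 is claimed, and superconductivity in the Hubbard model is neither
proved nor disproved by anything in this file.
-/

noncomputable section

open scoped ComplexOrder ComplexConjugate Matrix.Norms.L2Operator
open Filter Topology Matrix Finset
open Literature.MathematicalPhysics.QuantumLattice
open Literature.Probability.LatticeModels
open Summit.Ventures.CertifiedManyBodySolver.Theorems.TcThermcert1.CurrentCovarianceNonVacuity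

namespace Summit.Ventures.CertifiedManyBodySolver.Theorems.TcThermcert1.CanonicalDensityPlateau

/-! ## §1 The infinite-temperature sector state is the counting state -/

section Generic

variable {m : Type*} [Fintype m] [DecidableEq m] (p : m → Prop) [DecidablePred p]

/-- At `β = 0` the compressed Gibbs state is the normalised trace of the block: `ω_p(B) = (Σ_{s ∈ p} B_{ss}) / #p`.
[folklore] -/
theorem gibbsState_zero_toBlock_eq (H B : Matrix m m ℂ) :
    gibbsState 0 (H.toBlock p p) (B.toBlock p p) =
      (∑ s : {s // p s}, B s s) / (Fintype.card {s // p s} : ℂ) := by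
  rw [gibbsState_apply, gibbsWeight_zero, one_mul, partitionFn, gibbsWeight_zero, Matrix.trace_one,
    div_eq_inv_mul]
  rfl

/-- Counting under a bijection. [folklore] -/
theorem card_filter_univ_eq_of_equiv {α : Type*} [Fintype α] (e : α ≃ α) (P Q : α → Prop)
    [DecidablePred P] [DecidablePred Q] (h : ∀ a, P a ↔ Q (e a)) :
    (Finset.univ.filter P).card = (Finset.univ.filter Q).card :=
  Finset.card_equiv e fun a => by simpa only [Finset.mem_filter, Finset.mem_univ, true_and] using h a

/-- A subtype count is a conjunction count (one membership). [folklore] -/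
theorem card_filter_univ_subtype_mem {α : Type*} [Fintype α] [DecidableEq α] (R : Finset α → Prop)
    [DecidablePred R] (o : α) :
    (Finset.univ.filter fun s : {s // R s} => o ∈ (s : Finset α)).card =
      (Finset.univ.filter fun s : Finset α => R s ∧ o ∈ s).card := by
  refine Finset.card_bij (fun s _ => (s : Finset α)) (fun s hs => ?_) (fun s _ t _ hst => Subtype.ext hst)
    (fun b hb => ?_)
  · exact Finset.mem_filter.2 ⟨Finset.mem_univ _, s.2, (Finset.mem_filter.1 hs).2⟩
  · obtain ⟨-, hR, ho⟩ := Finset.mem_filter.1 hb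
    exact ⟨⟨b, hR⟩, Finset.mem_filter.2 ⟨Finset.mem_univ _, ho⟩, rfl⟩

/-- A subtype count is a conjunction count (two memberships). [folklore] -/
theorem card_filter_univ_subtype_mem_mem {α : Type*} [Fintype α] [DecidableEq α] (R : Finset α → Prop)
    [DecidablePred R] (o o' : α) :
    (Finset.univ.filter fun s : {s // R s} => o ∈ (s : Finset α) ∧ o' ∈ (s : Finset α)).card =
      (Finset.univ.filter fun s : Finset α => (R s ∧ o ∈ s) ∧ o' ∈ s).card := by
  refine Finset.card_bij (fun s _ => (s : Finset α)) (fun s hs => ?_) (fun s _ t _ hst => Subtype.ext hst)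
    (fun b hb => ?_)
  · obtain ⟨-, ho, ho'⟩ := Finset.mem_filter.1 hs
    exact Finset.mem_filter.2 ⟨Finset.mem_univ _, ⟨s.2, ho⟩, ho'⟩
  · obtain ⟨-, ⟨hR, ho⟩, ho'⟩ := Finset.mem_filter.1 hb
    exact ⟨⟨b, hR⟩, Finset.mem_filter.2 ⟨Finset.mem_univ _, ho, ho'⟩, rfl⟩

end Generic

/-! ## §2 Exchangeability and sum rules in an `(N↑, N↓)` sector -/

section Counting

variable {Λ : Type*} [LinearOrder Λ] [Fintype Λ]

omit [LinearOrder Λ] [Fintype Λ] in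
/-- Spin-`0` orbitals over distinct sites are distinct. [folklore] -/
theorem orb_zero_ne {x y : Λ} (h : x ≠ y) : orb x 0 ≠ orb y 0 :=
  fun e => h (congrArg (fun k : Orb Λ => (ofLex k).1) e)

omit [Fintype Λ] in
/-- A swap of two orbitals of equal spin does not change any spin. [folklore] -/
theorem snd_swap_of_snd_eq {o₁ o₂ : Orb Λ} (h : (ofLex o₁).2 = (ofLex o₂).2) (i : Orb Λ) :
    (ofLex (Equiv.swap o₁ o₂ i)).2 = (ofLex i).2 := by
  rcases eq_or_ne i o₁ with rfl | h1
  · rw [Equiv.swap_apply_left, h]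
  · rcases eq_or_ne i o₂ with rfl | h2
    · rw [Equiv.swap_apply_right, h]
    · rw [Equiv.swap_apply_of_ne_of_ne h1 h2]

omit [Fintype Λ] in
/-- **Exchangeability of the sector**: a swap of two orbitals of equal spin preserves the `(N↑, N↓) = (M, M)` coordinate
sector `{s : #s = 2M, #s↑ = M}`. [folklore] -/
theorem sector_finsetCongr_swap_iff {o₁ o₂ : Orb Λ} (h : (ofLex o₁).2 = (ofLex o₂).2) (M : ℕ)
    (s : Finset (Orb Λ)) :
    (((Equiv.swap o₁ o₂).finsetCongr s).card = 2 * M ∧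
        2 * (((Equiv.swap o₁ o₂).finsetCongr s).filter fun i => (ofLex i).2 = 0).card = 2 * M) ↔
      (s.card = 2 * M ∧ 2 * (s.filter fun i => (ofLex i).2 = 0).card = 2 * M) := by
  have h1 : ((Equiv.swap o₁ o₂).finsetCongr s).card = s.card := by
    rw [Equiv.finsetCongr_apply, Finset.card_map]
  have h2 : (((Equiv.swap o₁ o₂).finsetCongr s).filter fun i => (ofLex i).2 = 0).card =
      (s.filter fun i => (ofLex i).2 = 0).card := by
    refine (Finset.card_equiv (Equiv.swap o₁ o₂) fun i => ?_).symm
    rw [Finset.mem_filter, Finset.mem_filter, Equiv.finsetCongr_apply, Finset.mem_map_equiv,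
      Equiv.symm_apply_apply, snd_swap_of_snd_eq h]
  rw [h1, h2]

/-- The sites whose spin-`0` orbital is occupied in `s` count the spin-`0` orbitals of `s`. [folklore] -/
theorem card_filter_orb_mem (s : Finset (Orb Λ)) :
    (Finset.univ.filter fun x : Λ => orb x 0 ∈ s).card = (s.filter fun i => (ofLex i).2 = 0).card := by
  refine Finset.card_bij (fun x _ => orb x 0) (fun x hx => ?_) (fun x _ y _ hxy => ?_) (fun i hi => ?_)
  · exact Finset.mem_filter.2 ⟨(Finset.mem_filter.1 hx).2, rfl⟩
  · exact congrArg (fun k : Orb Λ => (ofLex k).1) hxy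
  · obtain ⟨hi, hi0⟩ := Finset.mem_filter.1 hi
    have hi' : orb (ofLex i).1 0 = i := by rw [← hi0]; rfl
    exact ⟨(ofLex i).1, Finset.mem_filter.2 ⟨Finset.mem_univ _, by rw [hi']; exact hi⟩, hi'⟩

/-- **Sum rule**: summed over the sites, the configurations of `R` containing the site's spin-`0` orbital are counted `M`
times each, when every configuration of `R` has exactly `M` spin-`0` orbitals (`Σ_x n_{x↑} = N↑`). [folklore] -/
theorem sum_card_filter_mem_eq (R : Finset (Orb Λ) → Prop) [DecidablePred R] {M : ℕ}
    (hRM : ∀ s, R s → (s.filter fun i => (ofLex i).2 = 0).card = M) :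
    ∑ x : Λ, (Finset.univ.filter fun s : Finset (Orb Λ) => R s ∧ orb x 0 ∈ s).card =
      M * (Finset.univ.filter R).card := by
  simp_rw [Finset.card_filter]
  rw [Finset.sum_comm, Finset.mul_sum]
  refine Finset.sum_congr rfl fun s _ => ?_
  by_cases hs : R s
  · rw [if_pos hs, mul_one, ← hRM s hs, ← card_filter_orb_mem, Finset.card_filter]
    exact Finset.sum_congr rfl fun x _ => if_congr ⟨fun h => h.2, fun h => ⟨hs, h⟩⟩ rfl rfl
  · rw [if_neg hs, mul_zero]
    exact Finset.sum_eq_zero fun x _ => if_neg fun h => hs h.1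

/-- Exchangeability, one-point: `#{s ∈ R : (x,↑) ∈ s}` does not depend on the site `x` when `R` is invariant under
spin-`0` swaps. [folklore] -/
theorem card_filter_mem_eq_of_swap (R : Finset (Orb Λ) → Prop) [DecidablePred R]
    (hR : ∀ (x x' : Λ) (s : Finset (Orb Λ)), R ((Equiv.swap (orb x 0) (orb x' 0)).finsetCongr s) ↔ R s)
    (x x' : Λ) :
    (Finset.univ.filter fun s : Finset (Orb Λ) => R s ∧ orb x 0 ∈ s).card =
      (Finset.univ.filter fun s : Finset (Orb Λ) => R s ∧ orb x' 0 ∈ s).card := by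
  refine card_filter_univ_eq_of_equiv ((Equiv.swap (orb x 0) (orb x' 0)).finsetCongr) _ _ fun s => ?_
  rw [hR, Equiv.finsetCongr_apply, Finset.mem_map_equiv, Equiv.symm_swap, Equiv.swap_apply_right]

/-- Exchangeability, two-point: `#{s ∈ R : (x,↑), (a,↑) ∈ s}` does not depend on `a ≠ x` when `R` is invariant under
spin-`0` swaps. [folklore] -/
theorem card_filter_mem_mem_eq_of_swap (R : Finset (Orb Λ) → Prop) [DecidablePred R]
    (hR : ∀ (x x' : Λ) (s : Finset (Orb Λ)), R ((Equiv.swap (orb x 0) (orb x' 0)).finsetCongr s) ↔ R s)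
    {x a a' : Λ} (ha : a ≠ x) (ha' : a' ≠ x) :
    (Finset.univ.filter fun s : Finset (Orb Λ) => (R s ∧ orb x 0 ∈ s) ∧ orb a 0 ∈ s).card =
      (Finset.univ.filter fun s : Finset (Orb Λ) => (R s ∧ orb x 0 ∈ s) ∧ orb a' 0 ∈ s).card := by
  refine card_filter_univ_eq_of_equiv ((Equiv.swap (orb a 0) (orb a' 0)).finsetCongr) _ _ fun s => ?_
  have hx : Equiv.swap (orb a 0) (orb a' 0) (orb x 0) = orb x 0 :=
    Equiv.swap_apply_of_ne_of_ne (orb_zero_ne ha.symm) (orb_zero_ne ha'.symm)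
  rw [hR, Equiv.finsetCongr_apply, Finset.mem_map_equiv, Finset.mem_map_equiv, Equiv.symm_swap, hx,
    Equiv.swap_apply_right]

/-- **One-point sum rule**: `|Λ| · #{s ∈ R : (x,↑) ∈ s} = M · #R`, i.e. `ω₀(n_{x↑}) = M/|Λ|`. [folklore] -/
theorem card_mul_card_filter_mem_eq (R : Finset (Orb Λ) → Prop) [DecidablePred R] {M : ℕ}
    (hR : ∀ (x x' : Λ) (s : Finset (Orb Λ)), R ((Equiv.swap (orb x 0) (orb x' 0)).finsetCongr s) ↔ R s)
    (hRM : ∀ s, R s → (s.filter fun i => (ofLex i).2 = 0).card = M) (x : Λ) :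
    Fintype.card Λ * (Finset.univ.filter fun s : Finset (Orb Λ) => R s ∧ orb x 0 ∈ s).card =
      M * (Finset.univ.filter R).card := by
  rw [← sum_card_filter_mem_eq R hRM, Finset.sum_congr rfl fun x' _ => card_filter_mem_eq_of_swap R hR x' x,
    Finset.sum_const, Finset.card_univ, smul_eq_mul]

/-- **Two-point sum rule**: `N₁ + (|Λ| - 1) · N₂ = M · N₁` for the one- and two-point counts (`a ≠ x`), i.e.
`ω₀(n_{x↑} n_{a↑}) = M(M-1)/(|Λ|(|Λ|-1))`. [folklore] -/
theorem card_filter_mem_add_eq (R : Finset (Orb Λ) → Prop) [DecidablePred R] {M : ℕ}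
    (hR : ∀ (x x' : Λ) (s : Finset (Orb Λ)), R ((Equiv.swap (orb x 0) (orb x' 0)).finsetCongr s) ↔ R s)
    (hRM : ∀ s, R s → (s.filter fun i => (ofLex i).2 = 0).card = M) {x a : Λ} (hxa : a ≠ x) :
    (Finset.univ.filter fun s : Finset (Orb Λ) => R s ∧ orb x 0 ∈ s).card +
        (Fintype.card Λ - 1) *
          (Finset.univ.filter fun s : Finset (Orb Λ) => (R s ∧ orb x 0 ∈ s) ∧ orb a 0 ∈ s).card =
      M * (Finset.univ.filter fun s : Finset (Orb Λ) => R s ∧ orb x 0 ∈ s).card := by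
  have hRM' : ∀ s, (R s ∧ orb x 0 ∈ s) → (s.filter fun i => (ofLex i).2 = 0).card = M :=
    fun s hs => hRM s hs.1
  rw [← sum_card_filter_mem_eq (fun s => R s ∧ orb x 0 ∈ s) hRM', ← Finset.add_sum_erase _ _ (Finset.mem_univ x)]
  congr 1
  · exact congrArg Finset.card (Finset.filter_congr fun s _ => ⟨fun h => ⟨h, h.2⟩, fun h => h.1⟩)
  · rw [Finset.sum_congr rfl fun a' ha' =>
        card_filter_mem_mem_eq_of_swap R hR (Finset.ne_of_mem_erase ha') hxa,
      Finset.sum_const, Finset.card_erase_of_mem (Finset.mem_univ x), Finset.card_univ, smul_eq_mul]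

/-- Diagonal sum of `n_{y↑}` over a sector = one-point count. [folklore] -/
theorem sum_subtype_numberOp_apply (R : Finset (Orb Λ) → Prop) [DecidablePred R] (y : Λ) :
    ∑ s : {s // R s}, (numberOp y 0 : Matrix (Finset (Orb Λ)) (Finset (Orb Λ)) ℂ) s s =
      ((Finset.univ.filter fun s : Finset (Orb Λ) => R s ∧ orb y 0 ∈ s).card : ℂ) := by
  rw [show (numberOp y 0 : Matrix (Finset (Orb Λ)) (Finset (Orb Λ)) ℂ) =
      Matrix.diagonal (fun s => if orb y 0 ∈ s then 1 else 0) from numberAt_eq_diagonal (orb y 0)]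
  simp_rw [Matrix.diagonal_apply_eq]
  rw [Finset.sum_boole, card_filter_univ_subtype_mem]

/-- Diagonal sum of `n_{x↑} n_{a↑}` over a sector = two-point count. [folklore] -/
theorem sum_subtype_numberOp_mul_numberOp_apply (R : Finset (Orb Λ) → Prop) [DecidablePred R] (x a : Λ) :
    ∑ s : {s // R s}, (numberOp x 0 * numberOp a 0 : Matrix (Finset (Orb Λ)) (Finset (Orb Λ)) ℂ) s s =
      ((Finset.univ.filter fun s : Finset (Orb Λ) => (R s ∧ orb x 0 ∈ s) ∧ orb a 0 ∈ s).card : ℂ) := by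
  rw [show (numberOp x 0 : Matrix (Finset (Orb Λ)) (Finset (Orb Λ)) ℂ) =
      Matrix.diagonal (fun s => if orb x 0 ∈ s then 1 else 0) from numberAt_eq_diagonal (orb x 0),
    show (numberOp a 0 : Matrix (Finset (Orb Λ)) (Finset (Orb Λ)) ℂ) =
      Matrix.diagonal (fun s => if orb a 0 ∈ s then 1 else 0) from numberAt_eq_diagonal (orb a 0),
    Matrix.diagonal_mul_diagonal]
  simp_rw [Matrix.diagonal_apply_eq, boole_mul, ← ite_and]
  rw [Finset.sum_boole, card_filter_univ_subtype_mem_mem]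

/-- **The canonical density plateau at `β = 0`** (Lebowitz–Percus–Verlet ensemble correction, exact on a finite volume):
in the normalised trace over a coordinate sector `R` that is exchangeable under spin-`0` swaps and has `N↑ = M`, for two
distinct sites `x ≠ a`, `ω₀(n_{x↑} n_{a↑}) - ω₀(n_{x↑}) ω₀(n_{a↑}) = -M(|Λ|-M) / (|Λ|²(|Λ|-1))` — independent of the distance
of `x` from `a`, and of the (irrelevant at `β = 0`) Hamiltonian `H`. [cite: LebowitzPercusVerlet1967, §II; folklore] -/
theorem densityCov_beta_zero_eq [DecidableEq (Finset (Orb Λ))] (R : Finset (Orb Λ) → Prop) [DecidablePred R] {M : ℕ}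
    (hR : ∀ (x x' : Λ) (s : Finset (Orb Λ)), R ((Equiv.swap (orb x 0) (orb x' 0)).finsetCongr s) ↔ R s)
    (hRM : ∀ s, R s → (s.filter fun i => (ofLex i).2 = 0).card = M) (hne : ∃ s, R s)
    (hV : 2 ≤ Fintype.card Λ) {x a : Λ} (hxa : a ≠ x) (H : Matrix (Finset (Orb Λ)) (Finset (Orb Λ)) ℂ) :
    gibbsState 0 (H.toBlock R R) ((numberOp x 0 * numberOp a 0).toBlock R R)
        - gibbsState 0 (H.toBlock R R) ((numberOp x 0).toBlock R R) *
          gibbsState 0 (H.toBlock R R) ((numberOp a 0).toBlock R R)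
      = ((-((M : ℝ) * (Fintype.card Λ - M)) / ((Fintype.card Λ : ℝ) ^ 2 * (Fintype.card Λ - 1)) : ℝ) : ℂ) := by
  rw [gibbsState_zero_toBlock_eq, gibbsState_zero_toBlock_eq, gibbsState_zero_toBlock_eq, Fintype.card_subtype,
    sum_subtype_numberOp_mul_numberOp_apply, sum_subtype_numberOp_apply, sum_subtype_numberOp_apply,
    card_filter_mem_eq_of_swap R hR a x]
  have h1 := card_mul_card_filter_mem_eq R hR hRM x
  have h2 := card_filter_mem_add_eq R hR hRM hxa
  set V := Fintype.card Λ with hVdef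
  set D := (Finset.univ.filter R).card
  set N₁ := (Finset.univ.filter fun s : Finset (Orb Λ) => R s ∧ orb x 0 ∈ s).card
  set N₂ := (Finset.univ.filter fun s : Finset (Orb Λ) => (R s ∧ orb x 0 ∈ s) ∧ orb a 0 ∈ s).card
  have hD : (D : ℂ) ≠ 0 := by
    obtain ⟨s, hs⟩ := hne
    exact Nat.cast_ne_zero.2 (Finset.card_pos.2 ⟨s, Finset.mem_filter.2 ⟨Finset.mem_univ _, hs⟩⟩).ne'
  have hV0 : (V : ℂ) ≠ 0 := Nat.cast_ne_zero.2 (by omega)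
  have hV1 : (V : ℂ) - 1 ≠ 0 := by
    have : ((V - 1 : ℕ) : ℂ) ≠ 0 := Nat.cast_ne_zero.2 (by omega)
    rwa [Nat.cast_sub (by omega : 1 ≤ V), Nat.cast_one] at this
  have h1' : (V : ℂ) * N₁ = M * D := by exact_mod_cast h1
  have h2' : (N₁ : ℂ) + ((V : ℂ) - 1) * N₂ = M * N₁ := by
    rw [← Nat.cast_one, ← Nat.cast_sub (by omega : 1 ≤ V)]
    exact_mod_cast h2
  have hN₁ : (N₁ : ℂ) = (M : ℂ) * D / V := by
    rw [eq_div_iff hV0]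
    linear_combination h1'
  have hN₂ : (N₂ : ℂ) = ((M : ℂ) - 1) * N₁ / (V - 1) := by
    rw [eq_div_iff hV1]
    linear_combination h2'
  rw [hN₂, hN₁]
  push_cast
  field_simp
  ring


/-- Off-diagonal entries of a number operator vanish (it is diagonal in the occupation basis). [folklore] -/
theorem numberOp_apply_of_ne {s t : Finset (Orb Λ)} (h : s ≠ t) (x : Λ) (σ : Fin 2) :
    (numberOp x σ : Matrix (Finset (Orb Λ)) (Finset (Orb Λ)) ℂ) s t = 0 := by
  rw [show (numberOp x σ : Matrix (Finset (Orb Λ)) (Finset (Orb Λ)) ℂ) =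
      Matrix.diagonal (fun s => if orb x σ ∈ s then 1 else 0) from numberAt_eq_diagonal (orb x σ)]
  exact Matrix.diagonal_apply_ne _ h

/-- **The plateau in a fixed-`(N↑, N↓) = (M, M)` sector** (the line's `sectorPred` shape `|s| = 2M ∧ 2·#{↑ ∈ s} = 2M`):
for `x ≠ a` and ANY Hamiltonian `H`, at `β = 0`,
`⟨n_{x↑} n_{a↑}⟩ - ⟨n_{x↑}⟩⟨n_{a↑}⟩ = -M(|Λ| - M) / (|Λ|²(|Λ| - 1))`, independently of the distance between `x` and `a`.
The `DecidableEq (Finset (Orb Λ))` instance entering the Gibbs state is a binder, so the identity instantiates on the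
torus with the torus files' shortcut instance. [cite: LebowitzPercusVerlet1967, §II; folklore] -/
theorem densityCov_sector_beta_zero_eq [DecidableEq (Finset (Orb Λ))] (M : ℕ)
    (hne : ∃ s : Finset (Orb Λ), s.card = 2 * M ∧ 2 * (s.filter fun i => (ofLex i).2 = 0).card = 2 * M)
    (hV : 2 ≤ Fintype.card Λ) {x a : Λ} (hxa : a ≠ x) (H : Matrix (Finset (Orb Λ)) (Finset (Orb Λ)) ℂ) :
    gibbsState 0
          (H.toBlock (fun s => s.card = 2 * M ∧ 2 * (s.filter fun i => (ofLex i).2 = 0).card = 2 * M)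
            (fun s => s.card = 2 * M ∧ 2 * (s.filter fun i => (ofLex i).2 = 0).card = 2 * M))
          ((numberOp x 0 * numberOp a 0).toBlock
            (fun s => s.card = 2 * M ∧ 2 * (s.filter fun i => (ofLex i).2 = 0).card = 2 * M)
            (fun s => s.card = 2 * M ∧ 2 * (s.filter fun i => (ofLex i).2 = 0).card = 2 * M))
        - gibbsState 0
            (H.toBlock (fun s => s.card = 2 * M ∧ 2 * (s.filter fun i => (ofLex i).2 = 0).card = 2 * M)
              (fun s => s.card = 2 * M ∧ 2 * (s.filter fun i => (ofLex i).2 = 0).card = 2 * M))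
            ((numberOp x 0).toBlock
              (fun s => s.card = 2 * M ∧ 2 * (s.filter fun i => (ofLex i).2 = 0).card = 2 * M)
              (fun s => s.card = 2 * M ∧ 2 * (s.filter fun i => (ofLex i).2 = 0).card = 2 * M)) *
          gibbsState 0
            (H.toBlock (fun s => s.card = 2 * M ∧ 2 * (s.filter fun i => (ofLex i).2 = 0).card = 2 * M)
              (fun s => s.card = 2 * M ∧ 2 * (s.filter fun i => (ofLex i).2 = 0).card = 2 * M))
            ((numberOp a 0).toBlock
              (fun s => s.card = 2 * M ∧ 2 * (s.filter fun i => (ofLex i).2 = 0).card = 2 * M)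
              (fun s => s.card = 2 * M ∧ 2 * (s.filter fun i => (ofLex i).2 = 0).card = 2 * M))
      = ((-((M : ℝ) * (Fintype.card Λ - M)) / ((Fintype.card Λ : ℝ) ^ 2 * (Fintype.card Λ - 1)) : ℝ) : ℂ) :=
  densityCov_beta_zero_eq (fun s => s.card = 2 * M ∧ 2 * (s.filter fun i => (ofLex i).2 = 0).card = 2 * M)
    (fun x x' s => sector_finsetCongr_swap_iff (o₁ := orb x 0) (o₂ := orb x' 0) rfl M s)
    (fun s hs => by have h2 := hs.2; omega) hne hV hxa H

end Counting


end Summit.Ventures.CertifiedManyBodySolver.Theorems.TcThermcert1.CanonicalDensityPlateau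

end
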